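import Mathlib.Analysis.InnerProductSpace.PiL2
import Mathlib.MeasureTheory.Integral.DominatedConvergence
import Literature.Analysis.FluidPDE.TaoEnergyLocalisationProofs
import Literature.Analysis.PDE.NewtonianKernel
import Summits.NavierStokesRegularity.NavierStokesRegularity.Theorems.HardyPointSinkHardyBalanceLawWeights
import Summits.NavierStokesRegularity.NavierStokesRegularity.Theorems.HardyPointSinkHardyBalanceLawIntegrability
import Summits.NavierStokesRegularity.NavierStokesRegularity.Theorems.HardyPointSinkHardyBalanceLawLimits
import HarnessLib

/-!
# Route HardyPointSink — `HardyEnergyBound`: the solenoidal Hardy flux identity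

Helper file for item stmt-NavierStokesRegularity-7979 (`HardyEnergyBound`, line `birth`, stub
`stub_solenoidalHardyFlux`). For a smooth divergence-free field `v` on `ℝ³`, a smooth compactly
supported `φ` and any centre `x₀`,

`∫ Dφ(x)(v x) / |x - x₀| dx = ∫ φ(x) ⟨v x, x - x₀⟩ / |x - x₀|³ dx`,

i.e. `∫ ⟨v, ∇(φ/r)⟩ = 0` with `r = |x - x₀|`: this is why the undetermined pressure constant drops
out of the local energy identity tested against `φ/r`.

## Proof

The weight `φ/r` is singular at `x₀`, so we regularise: `ψₙ(x) = regKernel aₙ (x - x₀) φ(x)` with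
`aₙ = (n+1)⁻² → 0⁺` (`regKernel a ξ = (‖ξ‖² + a)^{-1/2}` in `ℝ³`) is `C¹` with compact support,
hence `∫ Dψₙ(v) = ∫ div(ψₙ v) = 0` (`integral_fderiv_apply_eq_zero_of_isDivFree`). By the Leibniz
rule `Dψₙ(x)(v x) = regKernel aₙ (x - x₀) Dφ(x)(v x) - φ(x) (‖x - x₀‖² + aₙ)^{-3/2} ⟨x - x₀, v x⟩`,
so `∫ Dφ(v) regKernel aₙ (· - x₀) = ∫ (‖· - x₀‖² + aₙ)^{-3/2} φ ⟨v, · - x₀⟩` for every `n`. Both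
sides converge by dominated convergence (the Hardy-weight and head-flux limits of
`…HardyBalanceLawLimits`, with trivial cut-off `χₙ = 1`; a continuous compactly supported
function is `O((1 + ‖x‖)⁻ᵏ)` for every `k`), and the limits are the two sides of the claim.
[folklore; Majda–Bertozzi, Prop. 1.13]
-/

noncomputable section

open MeasureTheory Metric Set Filter Topology InnerProductSpace
open Literature.Analysis.PDE Literature.Analysis.FluidPDE
open scoped RealInnerProductSpace

set_option linter.dupNamespace false -- nested layout Summit.<S>.<Sub>, Sub = S (D-0017)

namespace Summit.NavierStokesRegularity.NavierStokesRegularity.Theorems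

/-- A continuous compactly supported function is `O((1 + ‖x‖)⁻ᵏ)`:
`|G x| ≤ B ((1 + ‖x‖)ᵏ)⁻¹` for some `B`. -/
theorem hardyEnergyBound_solenoidalHardyFlux_decay {G : EuclideanSpace ℝ (Fin 3) → ℝ}
    (hG : Continuous G) (hGc : HasCompactSupport G) (k : ℕ) :
    ∃ B : ℝ, ∀ x, |G x| ≤ B * ((1 + ‖x‖) ^ k)⁻¹ := by
  obtain ⟨B, hB⟩ := (hG.mul (by fun_prop : Continuous fun x : EuclideanSpace ℝ (Fin 3) =>
    (1 + ‖x‖) ^ k)).bounded_above_of_compact_support hGc.mul_right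
  refine ⟨B, fun x => ?_⟩
  have hpos : 0 < (1 + ‖x‖) ^ k := by positivity
  have h := hB x
  rw [Real.norm_eq_abs, Pi.mul_apply, abs_mul, abs_of_pos hpos] at h
  calc |G x| = |G x| * (1 + ‖x‖) ^ k * ((1 + ‖x‖) ^ k)⁻¹ := by
        rw [mul_inv_cancel_right₀ hpos.ne']
    _ ≤ B * ((1 + ‖x‖) ^ k)⁻¹ := mul_le_mul_of_nonneg_right h (inv_nonneg.2 hpos.le)

/-- The transport density `x ↦ Dφ(x)(v x)` of a smooth compactly supported `φ` along a smooth
field `v` is continuous, compactly supported and `O((1 + ‖x‖)⁻⁴)`. -/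
theorem hardyEnergyBound_solenoidalHardyFlux_transport_decay
    {v : EuclideanSpace ℝ (Fin 3) → EuclideanSpace ℝ (Fin 3)} (hv : ContDiff ℝ 1 v)
    {φ : EuclideanSpace ℝ (Fin 3) → ℝ} (hφ : ContDiff ℝ 1 φ) (hφc : HasCompactSupport φ) :
    Continuous (fun x => fderiv ℝ φ x (v x)) ∧
      ∃ B : ℝ, ∀ x, |fderiv ℝ φ x (v x)| ≤ B * ((1 + ‖x‖) ^ 4)⁻¹ := by
  have hc : Continuous (fun x => fderiv ℝ φ x (v x)) :=
    (hφ.continuous_fderiv one_ne_zero).clm_apply hv.continuous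
  have hs : HasCompactSupport (fun x => fderiv ℝ φ x (v x)) :=
    (hφc.fderiv ℝ).mono fun x hx h0 => hx (by simp [h0])
  exact ⟨hc, hardyEnergyBound_solenoidalHardyFlux_decay hc hs 4⟩

/-- The head-flux density `W(x) = φ(x) ⟨v x, x - x₀⟩` of a compactly supported continuous `φ`
and a continuous field `v` is continuous with `|W x| ≤ B (1 + ‖x‖)⁻² |x - x₀|`. -/
theorem hardyEnergyBound_solenoidalHardyFlux_headFlux_decay (x₀ : EuclideanSpace ℝ (Fin 3))
    {v : EuclideanSpace ℝ (Fin 3) → EuclideanSpace ℝ (Fin 3)} (hv : Continuous v)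
    {φ : EuclideanSpace ℝ (Fin 3) → ℝ} (hφ : Continuous φ) (hφc : HasCompactSupport φ) :
    Continuous (fun x => φ x * ⟪v x, x - x₀⟫) ∧
      ∃ B : ℝ, ∀ x, |φ x * ⟪v x, x - x₀⟫| ≤ B * ((1 + ‖x‖) ^ 2)⁻¹ * ‖x - x₀‖ := by
  refine ⟨hφ.mul (hv.inner (continuous_id.sub continuous_const)), ?_⟩
  obtain ⟨B, hB⟩ := hardyEnergyBound_solenoidalHardyFlux_decay (G := fun x => φ x * ‖v x‖)
    (hφ.mul hv.norm) hφc.mul_right 2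
  refine ⟨B, fun x => ?_⟩
  have h1 : |⟪v x, x - x₀⟫| ≤ ‖v x‖ * ‖x - x₀‖ := abs_real_inner_le_norm _ _
  have h2 := hB x
  rw [abs_mul, abs_norm] at h2
  calc |φ x * ⟪v x, x - x₀⟫| = |φ x| * |⟪v x, x - x₀⟫| := abs_mul _ _
    _ ≤ |φ x| * (‖v x‖ * ‖x - x₀‖) := mul_le_mul_of_nonneg_left h1 (abs_nonneg _)
    _ = |φ x| * ‖v x‖ * ‖x - x₀‖ := by ring
    _ ≤ B * ((1 + ‖x‖) ^ 2)⁻¹ * ‖x - x₀‖ := mul_le_mul_of_nonneg_right h2 (norm_nonneg _)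

/-- **The regularised identity.** For `a > 0`, a `C¹` divergence-free `v` and a `C¹` compactly
supported `φ`: `∫ Dφ(v) · regKernel a (· - x₀) = ∫ (‖· - x₀‖² + a)^{-3/2} φ ⟨v, · - x₀⟩`
(the divergence theorem for `ψ = regKernel a (· - x₀) φ` and the Leibniz rule), granted the
integrability of both sides. -/
theorem hardyEnergyBound_solenoidalHardyFlux_reg (x₀ : EuclideanSpace ℝ (Fin 3)) {a : ℝ}
    (ha : 0 < a)
    {v : EuclideanSpace ℝ (Fin 3) → EuclideanSpace ℝ (Fin 3)} (hv : ContDiff ℝ 1 v)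
    (hdiv : VectorCalculus.IsDivFree v)
    {φ : EuclideanSpace ℝ (Fin 3) → ℝ} (hφ : ContDiff ℝ 1 φ) (hφc : HasCompactSupport φ)
    (hA : Integrable fun x => fderiv ℝ φ x (v x) * (Newtonian.regKernel a (x - x₀) * 1))
    (hB : Integrable fun x => 1 * (‖x - x₀‖ ^ 2 + a) ^ (-3 / 2 : ℝ) * (φ x * ⟪v x, x - x₀⟫)) :
    ∫ x, fderiv ℝ φ x (v x) * (Newtonian.regKernel a (x - x₀) * 1) =
      ∫ x, 1 * (‖x - x₀‖ ^ 2 + a) ^ (-3 / 2 : ℝ) * (φ x * ⟪v x, x - x₀⟫) := by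
  have hψ : ContDiff ℝ 1 (fun y => Newtonian.regKernel a (y - x₀) * φ y) :=
    (hardyPointSink_contDiff_weight ha x₀).mul hφ
  have hψc : HasCompactSupport (fun y => Newtonian.regKernel a (y - x₀) * φ y) := hφc.mul_left
  have h0 := integral_fderiv_apply_eq_zero_of_isDivFree hv hdiv hψ hψc
  have hpt : (fun x => fderiv ℝ φ x (v x) * (Newtonian.regKernel a (x - x₀) * 1) -
      1 * (‖x - x₀‖ ^ 2 + a) ^ (-3 / 2 : ℝ) * (φ x * ⟪v x, x - x₀⟫)) =
      fun x => fderiv ℝ (fun y => Newtonian.regKernel a (y - x₀) * φ y) x (v x) := by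
    funext x
    rw [hardyPointSink_fderiv_psi x₀ ha hφ x (v x), real_inner_comm (x - x₀) (v x)]
    ring
  have h1 := integral_sub hA hB
  rw [hpt, h0] at h1
  exact (sub_eq_zero.1 h1.symm)

/-- **The solenoidal Hardy flux identity** (stub `stub_solenoidalHardyFlux` of the line `birth` of
`HardyEnergyBound`). For a smooth divergence-free field `v` on `ℝ³`, a smooth compactly supported
`φ` and any `x₀`: `∫ Dφ(x)(v x)/|x - x₀| dx = ∫ φ(x) ⟨v x, x - x₀⟩/|x - x₀|³ dx`, i.e.
`∫ ⟨v, ∇(φ/r)⟩ = 0` — the pressure constant drops out of the `φ/r`-weighted local energy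
identity. [folklore; Majda–Bertozzi, Prop. 1.13] -/
theorem stub_solenoidalHardyFlux :
    ∀ (v : EuclideanSpace ℝ (Fin 3) → EuclideanSpace ℝ (Fin 3)), ContDiff ℝ (⊤ : ℕ∞) v →
      Literature.Analysis.FluidPDE.VectorCalculus.IsDivFree v →
      ∀ (φ : EuclideanSpace ℝ (Fin 3) → ℝ), ContDiff ℝ (⊤ : ℕ∞) φ → HasCompactSupport φ →
      ∀ x₀ : EuclideanSpace ℝ (Fin 3),
      ∫ x, fderiv ℝ φ x (v x) / ‖x - x₀‖ = ∫ x, φ x * inner ℝ (v x) (x - x₀) / ‖x - x₀‖ ^ 3 := by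
  intro v hv hdiv φ hφ hφc x₀
  have hv1 : ContDiff ℝ 1 v := hv.of_le (by exact_mod_cast le_top)
  have hφ1 : ContDiff ℝ 1 φ := hφ.of_le (by exact_mod_cast le_top)
  obtain ⟨hGc, B₁, hGB⟩ := hardyEnergyBound_solenoidalHardyFlux_transport_decay hv1 hφ1 hφc
  obtain ⟨hWc, B₂, hWB⟩ :=
    hardyEnergyBound_solenoidalHardyFlux_headFlux_decay x₀ hv.continuous hφ.continuous hφc
  obtain ⟨hA, -, hAi⟩ := hardyPointSink_tendsto_weight_term x₀ hardyPointSink_seq_pos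
    hardyPointSink_tendsto_seq (χ := fun _ _ => (1 : ℝ)) (fun _ => continuous_const)
    (fun _ _ => zero_le_one) (fun _ _ => le_rfl) (fun _ => Eventually.of_forall fun _ => rfl)
    hGc hGB
  obtain ⟨hB, -, hBi⟩ := hardyPointSink_tendsto_flux_term x₀ hardyPointSink_seq_pos
    hardyPointSink_tendsto_seq (χ := fun _ _ => (1 : ℝ)) (fun _ => continuous_const)
    (fun _ _ => zero_le_one) (fun _ _ => le_rfl) (fun _ => Eventually.of_forall fun _ => rfl)
    hWc hWB
  have heq : ∀ n : ℕ,
      ∫ x, fderiv ℝ φ x (v x) * (Newtonian.regKernel ((((n : ℝ) + 1)⁻¹) ^ 2) (x - x₀) * 1) =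
        ∫ x, 1 * (‖x - x₀‖ ^ 2 + (((n : ℝ) + 1)⁻¹) ^ 2) ^ (-3 / 2 : ℝ) * (φ x * ⟪v x, x - x₀⟫) :=
    fun n => hardyEnergyBound_solenoidalHardyFlux_reg x₀ (hardyPointSink_seq_pos n) hv1 hdiv hφ1
      hφc (hAi n) (hBi n)
  exact tendsto_nhds_unique (hA.congr heq) hB

end Summit.NavierStokesRegularity.NavierStokesRegularity.Theorems

end
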